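import Literature.Geometry.Lorentzian.CoordEntropyEvolution
import HarnessLib

/-!
# Perelman's entropy formula in coordinates: the pointwise identity of Topping's Prop. 8.2.6

A further layer of the coordinate tensor calculus (`CoordBochner`, `CoordEntropyEvolution`).
For a smooth one-parameter family of metric components `G` on `V × S` satisfying the Ricci flow
in coordinates `∂G/∂t = −2 Ric(G)`, a time-dependent function `f`, `C^∞` on `V × S`, and the
backwards time `τ` with `dτ/dt = −1`, Perelman's modified scalar (Topping 2006, (8.2.3))

  `P = τ(2Δf − |∇f|² + R) + f − n`      (`n = dim E`)

satisfies, **at any `(x, t)` where `f` solves `∂f/∂t = −Δf + |∇f|² − R + n/(2τ)` on `V × {t}`**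
(the third equation of Topping's system (8.2.1), equivalent to `□* u = 0` for
`u = (4πτ)^{-n/2} e^{-f}`), the pointwise identity behind the entropy formula
(**Topping 2006, Prop. 8.2.6**, divided by `u`; Perelman 2002, Prop. 9.1):

  `∂_t P + ΔP − 2⟨∇P, ∇f⟩ = 2τ |Ric + Hess f − G/(2τ)|²`

(`IsMetricFamilyOn.entropyIntegrand_identity`). The proof is Topping's (pp. 62–64 of the notes):
`∂_t Δf = Δ ∂_t f + 2⟨Ric, Hess f⟩` (Prop. 2.5.6, `hasDerivWithinAt_lapAt_ricciFlow`),
`∂_t |∇f|² = 2Ric(∇f,∇f) + 2⟨∇f, ∇∂_t f⟩` (`hasDerivWithinAt_gradSqAt_ricciFlow`),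
`∂_t R = ΔR + 2|Ric|²` (Prop. 2.5.4, `hasDerivWithinAt_scalAt_ricciFlow`), the Bochner formula
(`IsMetricOn.lapAt_gradSqAt`), and the expansion `|A − G/2τ|² = |A|² − tr A/τ + n/4τ²`.

Supporting material proved here: linearity of `hessAt`/`lapAt` in the function (sums, scalar
multiples, constants), `Δ c = 0`, smoothness of `Δf`, `|∇f|²` on `V`, and the value of the
time derivative of `P`. Everything is proved; the file introduces the definition
`entropyIntegrand` (the explicit scalar `P` as a family) and no statement of `Prop` type.

## References

* P. Topping, *Lectures on the Ricci flow*, LMS Lecture Note Series 325, CUP 2006, Prop. 8.2.6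
  with (8.2.3)–(8.2.8), Prop. 2.5.4, Prop. 2.5.6. [Topping2006]
* G. Perelman, *The entropy formula for the Ricci flow and its geometric applications*,
  arXiv:math/0211159 (2002), §3 (3.3)–(3.4) and §9, Prop. 9.1. [Perelman2002]
-/

noncomputable section

set_option maxSynthPendingDepth 3

open Set Filter ContinuousLinearMap Module
open scoped Topology ContDiff

namespace Literature.Geometry.Lorentzian

namespace MetricCoord

variable {E : Type*} [NormedAddCommGroup E] [NormedSpace ℝ E]

/-! ### Linearity of the coordinate Hessian and Laplacian in the function -/

section Linear

variable (G : E → E →L[ℝ] E →L[ℝ] ℝ) {x : E} {u v : E → ℝ}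

/-- `D(u + v) = Du + Dv` near `x` for functions `C²` at `x`, hence `D²(u+v)(x) = D²u(x) + D²v(x)`.
[folklore] -/
theorem fderiv_fderiv_add (hu : ContDiffAt ℝ 2 u x) (hv : ContDiffAt ℝ 2 v x) :
    fderiv ℝ (fderiv ℝ (fun y ↦ u y + v y)) x =
      fderiv ℝ (fderiv ℝ u) x + fderiv ℝ (fderiv ℝ v) x := by
  have heu : ∀ᶠ y in 𝓝 x, ContDiffAt ℝ 2 u y := hu.eventually (by simp)
  have hev : ∀ᶠ y in 𝓝 x, ContDiffAt ℝ 2 v y := hv.eventually (by simp)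
  have heq : fderiv ℝ (fun y ↦ u y + v y) =ᶠ[𝓝 x] fun y ↦ fderiv ℝ u y + fderiv ℝ v y := by
    filter_upwards [heu, hev] with y hyu hyv
    exact fderiv_fun_add (hyu.differentiableAt (by simp)) (hyv.differentiableAt (by simp))
  rw [heq.fderiv_eq]
  exact fderiv_fun_add ((hu.fderiv_right (m := 1) le_rfl).differentiableAt one_ne_zero)
    ((hv.fderiv_right (m := 1) le_rfl).differentiableAt one_ne_zero)

/-- `D²(c u)(x) = c D²u(x)` for `u` of class `C²` at `x`. [folklore] -/
theorem fderiv_fderiv_const_mul (hu : ContDiffAt ℝ 2 u x) (c : ℝ) :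
    fderiv ℝ (fderiv ℝ (fun y ↦ c * u y)) x = c • fderiv ℝ (fderiv ℝ u) x := by
  have heu : ∀ᶠ y in 𝓝 x, ContDiffAt ℝ 2 u y := hu.eventually (by simp)
  have heq : fderiv ℝ (fun y ↦ c * u y) =ᶠ[𝓝 x] fun y ↦ c • fderiv ℝ u y := by
    filter_upwards [heu] with y hyu
    exact fderiv_const_mul (hyu.differentiableAt (by simp)) c
  rw [heq.fderiv_eq]
  exact fderiv_fun_const_smul ((hu.fderiv_right (m := 1) le_rfl).differentiableAt one_ne_zero) c

/-- `D²(u + c)(x) = D²u(x)`. [folklore] -/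
theorem fderiv_fderiv_add_const (c : ℝ) :
    fderiv ℝ (fderiv ℝ (fun y ↦ u y + c)) x = fderiv ℝ (fderiv ℝ u) x := by
  have heq : fderiv ℝ (fun y ↦ u y + c) = fderiv ℝ u := by
    funext y; exact fderiv_add_const c
  rw [heq]

/-- **`Hess (u + v) = Hess u + Hess v`** for functions `C²` at `x`. [folklore] -/
theorem hessAt_add (hu : ContDiffAt ℝ 2 u x) (hv : ContDiffAt ℝ 2 v x) :
    hessAt G (fun y ↦ u y + v y) x = hessAt G u x + hessAt G v x := by
  ext Y Z
  simp only [hessAt_apply, fderiv_fderiv_add hu hv, _root_.add_apply,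
    fderiv_fun_add (hu.differentiableAt (by simp)) (hv.differentiableAt (by simp))]
  ring

/-- **`Hess (c u) = c Hess u`** for `u` of class `C²` at `x`. [folklore] -/
theorem hessAt_const_mul (hu : ContDiffAt ℝ 2 u x) (c : ℝ) :
    hessAt G (fun y ↦ c * u y) x = c • hessAt G u x := by
  ext Y Z
  simp only [hessAt_apply, fderiv_fderiv_const_mul hu c, _root_.smul_apply, smul_eq_mul,
    fderiv_const_mul (hu.differentiableAt (by simp)) c]
  ring

/-- `Hess (u + c) = Hess u`. [folklore] -/
theorem hessAt_add_const (c : ℝ) : hessAt G (fun y ↦ u y + c) x = hessAt G u x := by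
  ext Y Z
  simp only [hessAt_apply, fderiv_fderiv_add_const, fderiv_add_const]

/-- `Hess (−u) = −Hess u`. [folklore] -/
theorem hessAt_neg : hessAt G (fun y ↦ -u y) x = -hessAt G u x := by
  ext Y Z
  have h1 : fderiv ℝ (fun y ↦ -u y) = -fderiv ℝ u := funext fun y ↦ fderiv_fun_neg
  simp only [hessAt_apply, h1, Pi.neg_apply, fderiv_neg, _root_.neg_apply]
  ring

/-- `D²(u − v)(x) = D²u(x) − D²v(x)` for functions `C²` at `x`. [folklore] -/
theorem fderiv_fderiv_sub (hu : ContDiffAt ℝ 2 u x) (hv : ContDiffAt ℝ 2 v x) :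
    fderiv ℝ (fderiv ℝ (fun y ↦ u y - v y)) x =
      fderiv ℝ (fderiv ℝ u) x - fderiv ℝ (fderiv ℝ v) x := by
  have heu : ∀ᶠ y in 𝓝 x, ContDiffAt ℝ 2 u y := hu.eventually (by simp)
  have hev : ∀ᶠ y in 𝓝 x, ContDiffAt ℝ 2 v y := hv.eventually (by simp)
  have heq : fderiv ℝ (fun y ↦ u y - v y) =ᶠ[𝓝 x] fun y ↦ fderiv ℝ u y - fderiv ℝ v y := by
    filter_upwards [heu, hev] with y hyu hyv
    exact fderiv_fun_sub (hyu.differentiableAt (by simp)) (hyv.differentiableAt (by simp))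
  rw [heq.fderiv_eq]
  exact fderiv_fun_sub ((hu.fderiv_right (m := 1) le_rfl).differentiableAt one_ne_zero)
    ((hv.fderiv_right (m := 1) le_rfl).differentiableAt one_ne_zero)

/-- **`Hess (u − v) = Hess u − Hess v`** for functions `C²` at `x`. [folklore] -/
theorem hessAt_sub (hu : ContDiffAt ℝ 2 u x) (hv : ContDiffAt ℝ 2 v x) :
    hessAt G (fun y ↦ u y - v y) x = hessAt G u x - hessAt G v x := by
  ext Y Z
  simp only [hessAt_apply, fderiv_fderiv_sub hu hv, _root_.sub_apply,
    fderiv_fun_sub (hu.differentiableAt (by simp)) (hv.differentiableAt (by simp))]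
  ring

/-- `Hess (u − c) = Hess u`. [folklore] -/
theorem hessAt_sub_const (c : ℝ) : hessAt G (fun y ↦ u y - c) x = hessAt G u x := by
  simp only [sub_eq_add_neg]
  exact hessAt_add_const G (-c)

/-- The Hessian only depends on the germ of the function. [folklore] -/
theorem hessAt_congr_of_eventuallyEq (h : u =ᶠ[𝓝 x] v) : hessAt G u x = hessAt G v x := by
  ext Y Z
  simp only [hessAt_apply, h.fderiv_eq, (h.fderiv (𝕜 := ℝ)).fderiv_eq]

variable [FiniteDimensional ℝ E]

/-- **`Δ(u + v) = Δu + Δv`** for functions `C²` at `x`. [folklore] -/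
theorem lapAt_add (hu : ContDiffAt ℝ 2 u x) (hv : ContDiffAt ℝ 2 v x) :
    lapAt G (fun y ↦ u y + v y) x = lapAt G u x + lapAt G v x := by
  rw [lapAt, hessAt_add G hu hv, mtrAt_add, ← lapAt, ← lapAt]

/-- **`Δ(c u) = c Δu`** for `u` of class `C²` at `x`. [folklore] -/
theorem lapAt_const_mul (hu : ContDiffAt ℝ 2 u x) (c : ℝ) :
    lapAt G (fun y ↦ c * u y) x = c * lapAt G u x := by
  rw [lapAt, hessAt_const_mul G hu c, mtrAt_smul, ← lapAt]

/-- `Δ(u + c) = Δu`. [folklore] -/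
theorem lapAt_add_const (c : ℝ) : lapAt G (fun y ↦ u y + c) x = lapAt G u x := by
  rw [lapAt, hessAt_add_const, ← lapAt]

/-- `Δ(−u) = −Δu`. [folklore] -/
theorem lapAt_neg : lapAt G (fun y ↦ -u y) x = -lapAt G u x := by
  rw [lapAt, hessAt_neg, mtrAt_neg, ← lapAt]

/-- `Δ(u − v) = Δu − Δv` for functions `C²` at `x`. [folklore] -/
theorem lapAt_sub (hu : ContDiffAt ℝ 2 u x) (hv : ContDiffAt ℝ 2 v x) :
    lapAt G (fun y ↦ u y - v y) x = lapAt G u x - lapAt G v x := by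
  rw [lapAt, hessAt_sub G hu hv, mtrAt_sub, ← lapAt, ← lapAt]

/-- `Δ(u − c) = Δu`. [folklore] -/
theorem lapAt_sub_const (c : ℝ) : lapAt G (fun y ↦ u y - c) x = lapAt G u x := by
  rw [lapAt, hessAt_sub_const, ← lapAt]

/-- `Δ c = 0`. [folklore] -/
theorem lapAt_const (c : ℝ) : lapAt G (fun _ : E ↦ c) x = 0 := by
  rw [lapAt]
  have h : hessAt G (fun _ : E ↦ c) x = 0 := by
    ext Y Z
    simp [hessAt_apply]
  rw [h, show (0 : E →L[ℝ] E →L[ℝ] ℝ) = (0 : ℝ) • (0 : E →L[ℝ] E →L[ℝ] ℝ) by simp, mtrAt_smul]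
  ring

/-- The Laplacian only depends on the germ of the function. [folklore] -/
theorem lapAt_congr_of_eventuallyEq (h : u =ᶠ[𝓝 x] v) : lapAt G u x = lapAt G v x := by
  rw [lapAt, hessAt_congr_of_eventuallyEq G h, ← lapAt]

end Linear

/-! ### Smoothness of `Δf` and `|∇f|²` -/

section Smoothness

variable [CompleteSpace E] {G : E → E →L[ℝ] E →L[ℝ] ℝ} {V : Set E} {x : E} {f : E → ℝ}

/-- `|∇f|²` is `C^∞` on `V`. [folklore] -/
theorem IsMetricOn.contDiffOn_gradSqAt (hG : IsMetricOn G V) (hf : ContDiffOn ℝ ∞ f V) :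
    ContDiffOn ℝ ∞ (gradSqAt G f) V := by
  have hDf : ContDiffOn ℝ ∞ (fderiv ℝ f) V := hf.fderiv_of_isOpen hG.isOpen (by simp)
  exact hDf.clm_apply (hG.contDiffOn_sharpAt.clm_apply hDf)

variable [FiniteDimensional ℝ E]

/-- `Δf` is `C^∞` on `V`. [folklore] -/
theorem IsMetricOn.contDiffOn_lapAt (hG : IsMetricOn G V) (hf : ContDiffOn ℝ ∞ f V) :
    ContDiffOn ℝ ∞ (lapAt G f) V :=
  hG.contDiffOn_mtrAt (hG.contDiffOn_hessAt hf)

omit [CompleteSpace E] [FiniteDimensional ℝ E] in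
/-- `C^∞` on the open `V` gives `C²` at its points (the form used by the linearity lemmas).
[folklore] -/
theorem contDiffAt_two_of_contDiffOn (hV : IsOpen V) {u : E → ℝ} (hu : ContDiffOn ℝ ∞ u V)
    (hx : x ∈ V) : ContDiffAt ℝ 2 u x :=
  ((hu x hx).contDiffAt (hV.mem_nhds hx)).of_le (by norm_cast)

end Smoothness

/-! ### Perelman's scalar `P = τ(2Δf − |∇f|² + R) + f − n` and its time derivative -/

section Entropy

variable [FiniteDimensional ℝ E] [CompleteSpace E]

/-- **Perelman's modified integrand** `P = τ(2Δf − |∇f|² + R) + f − n` (Topping 2006, (8.2.3):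
`v = [τ(2Δf − |∇f|² + R) + f − n] u`; Perelman 2002, Prop. 9.1), as a time-dependent function
for the family `G` and the time-dependent function `f`, with `n = dim E`.
[cite: Topping2006, (8.2.3)] -/
def entropyIntegrand (G : ℝ → E → E →L[ℝ] E →L[ℝ] ℝ) (f : ℝ → E → ℝ) (τ : ℝ → ℝ) (s : ℝ) (y : E) : ℝ :=
  τ s * (2 * lapAt (G s) (f s) y - gradSqAt (G s) (f s) y + scalAt (G s) y) + f s y - finrank ℝ E

omit [CompleteSpace E] in
/-- Unfolding lemma for `entropyIntegrand`. [cite: Topping2006, (8.2.3)] -/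
theorem entropyIntegrand_apply (G : ℝ → E → E →L[ℝ] E →L[ℝ] ℝ) (f : ℝ → E → ℝ) (τ : ℝ → ℝ)
    (s : ℝ) (y : E) :
    entropyIntegrand G f τ s y = τ s * (2 * lapAt (G s) (f s) y - gradSqAt (G s) (f s) y
      + scalAt (G s) y) + f s y - finrank ℝ E := rfl

namespace IsMetricFamilyOn

variable {G : ℝ → E → E →L[ℝ] E →L[ℝ] ℝ} {S : Set ℝ} {V : Set E} {x : E} {t : ℝ} {f : ℝ → E → ℝ}
  {τ : ℝ → ℝ} {τ' : ℝ}
  (hG : IsMetricFamilyOn G S V)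
  (hfl : ∀ s ∈ S, ∀ y ∈ V, tDeriv G S s y = (-2 : ℝ) • ricAt (G s) y)
include hG hfl

/-- **The time derivative of `P` under the flow**: within `S`,
`∂_t P = τ' (2Δf − |∇f|² + R) + τ [2(Δḟ + 2⟨Ric, Hess f⟩) − (2Ric(♯Df,♯Df) + 2Dḟ(♯Df)) + (ΔR + 2|Ric|²)] + ḟ`
(Topping 2006, Prop. 2.5.6, the evolution of `|∇f|²`, and Prop. 2.5.4).
[cite: Topping2006, proof of Prop. 8.2.6, (8.2.5)–(8.2.7)] -/
theorem hasDerivWithinAt_entropyIntegrand (hf : ContDiffOn ℝ ∞ (fun p : E × ℝ ↦ f p.2 p.1) (V ×ˢ S))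
    (hτ : HasDerivWithinAt τ τ' S t) (hx : x ∈ V) (ht : t ∈ S) :
    HasDerivWithinAt (fun s ↦ entropyIntegrand G f τ s x)
      (τ' * (2 * lapAt (G t) (f t) x - gradSqAt (G t) (f t) x + scalAt (G t) x)
        + τ t * (2 * (lapAt (G t) (tDerivFun f S t) x
            + 2 * pairAt (G t) x (ricAt (G t) x) (hessAt (G t) (f t) x))
          - (2 * ricAt (G t) x (sharpAt (G t) x (fderiv ℝ (f t) x)) (sharpAt (G t) x (fderiv ℝ (f t) x))
            + 2 * fderiv ℝ (tDerivFun f S t) x (sharpAt (G t) x (fderiv ℝ (f t) x)))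
          + (lapAt (G t) (scalAt (G t)) x + 2 * normSqAt (G t) x (ricAt (G t) x)))
        + tDerivFun f S t x) S t := by
  have hL := hG.hasDerivWithinAt_lapAt_ricciFlow hfl hf hx ht
  have hg := hG.hasDerivWithinAt_gradSqAt_ricciFlow hfl hf hx ht
  have hR := hG.hasDerivWithinAt_scalAt_ricciFlow hfl hx ht
  have hF := hasDerivWithinAt_of_family hf hx ht
  have hQ := ((hL.const_mul 2).sub hg).add hR
  have hP := ((hτ.mul hQ).add hF).sub_const (finrank ℝ E : ℝ)
  refine (hP.congr_of_eventuallyEq_of_mem ?_ ht).congr_deriv ?_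
  · exact Filter.Eventually.of_forall fun s ↦ by
      simp only [entropyIntegrand_apply, Pi.add_apply, Pi.sub_apply, Pi.mul_apply]
  · simp only [Pi.add_apply, Pi.sub_apply]

/-- **Perelman's entropy formula, pointwise in coordinates (Topping 2006, Prop. 8.2.6 divided by
`u`; Perelman 2002, Prop. 9.1).** Let `G` be a smooth one-parameter family of metric components
on `V × S` satisfying the Ricci flow in coordinates `∂G/∂t = −2Ric(G)`; let `f` be `C^∞` on
`V × S` and `τ` differentiable within `S` at `t` with `dτ/dt = −1` and `τ(t) ≠ 0`. Suppose that
at time `t` the function `f` solves, on `V`, the third equation of (8.2.1):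
`∂f/∂t = −Δf + |∇f|² − R + n/(2τ)` (`n = dim E`). Then at every `x ∈ V`, with
`P = τ(2Δf − |∇f|² + R) + f − n` (`entropyIntegrand`) and `♯Df` the gradient,

  `∂_t P + ΔP − 2 DP(♯Df) = 2τ |Ric + Hess f − G/(2τ)|²_G`.

This is `−u⁻¹ □*(P u)` for `u = (4πτ)^{-n/2}e^{-f}` (Topping, (8.2.4)–(8.2.8)); the computation
is Topping's: Prop. 2.5.6, the evolution of `|∇f|²` and of `R` (Prop. 2.5.4), and the Bochner
formula. [cite: Topping2006, Prop. 8.2.6] [cite: Perelman2002, §9, Prop. 9.1] -/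
theorem entropyIntegrand_identity (hf : ContDiffOn ℝ ∞ (fun p : E × ℝ ↦ f p.2 p.1) (V ×ˢ S))
    (hτ : HasDerivWithinAt τ (-1) S t) (hτ0 : τ t ≠ 0) (hx : x ∈ V) (ht : t ∈ S)
    (hfeq : ∀ y ∈ V, tDerivFun f S t y = -lapAt (G t) (f t) y + gradSqAt (G t) (f t) y
      - scalAt (G t) y + finrank ℝ E / (2 * τ t)) :
    tDerivFun (entropyIntegrand G f τ) S t x + lapAt (G t) (entropyIntegrand G f τ t) x
      - 2 * fderiv ℝ (entropyIntegrand G f τ t) x (sharpAt (G t) x (fderiv ℝ (f t) x)) =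
      2 * τ t * normSqAt (G t) x
        (ricAt (G t) x + hessAt (G t) (f t) x - (2 * τ t)⁻¹ • G t x) := by
  have hGt := hG.isMetricOn t ht
  have hi := hGt.isInvertible x hx
  have hs := hGt.symm x hx
  have hV := hG.isOpen ht
  -- the slices at time `t` and their smoothness
  have hft : ContDiffOn ℝ ∞ (f t) V := contDiffOn_of_family hf ht
  have hLf : ContDiffOn ℝ ∞ (lapAt (G t) (f t)) V := hGt.contDiffOn_lapAt hft
  have hGf : ContDiffOn ℝ ∞ (gradSqAt (G t) (f t)) V := hGt.contDiffOn_gradSqAt hft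
  have hSc : ContDiffOn ℝ ∞ (scalAt (G t)) V := hGt.contDiffOn_scalAt
  have h2f := contDiffAt_two_of_contDiffOn hV hft hx
  have h2L := contDiffAt_two_of_contDiffOn hV hLf hx
  have h2G := contDiffAt_two_of_contDiffOn hV hGf hx
  have h2S := contDiffAt_two_of_contDiffOn hV hSc hx
  have hdf : DifferentiableAt ℝ (f t) x := h2f.differentiableAt (by simp)
  have hdL : DifferentiableAt ℝ (lapAt (G t) (f t)) x := h2L.differentiableAt (by simp)
  have hdG : DifferentiableAt ℝ (gradSqAt (G t) (f t)) x := h2G.differentiableAt (by simp)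
  have hdS : DifferentiableAt ℝ (scalAt (G t)) x := h2S.differentiableAt (by simp)
  -- abbreviations
  set τ₀ := τ t with hτ₀
  set n : ℝ := (finrank ℝ E : ℝ) with hn
  set ξ := sharpAt (G t) x (fderiv ℝ (f t) x) with hξ
  set H := hessAt (G t) (f t) x with hH
  set Rc := ricAt (G t) x with hRc
  set L := lapAt (G t) (f t) x with hL
  set g2 := gradSqAt (G t) (f t) x with hg2
  set R := scalAt (G t) x with hR
  set DL := fderiv ℝ (lapAt (G t) (f t)) x ξ with hDL
  set DS := fderiv ℝ (scalAt (G t)) x ξ with hDS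
  set LL := lapAt (G t) (lapAt (G t) (f t)) x with hLL
  set LG := lapAt (G t) (gradSqAt (G t) (f t)) x with hLG
  set LS := lapAt (G t) (scalAt (G t)) x with hLS
  -- (1) the equation for `ḟ` as a function near `x`, and its consequences
  set φ : E → ℝ := fun y ↦ -lapAt (G t) (f t) y + gradSqAt (G t) (f t) y - scalAt (G t) y
    + n / (2 * τ₀) with hφ
  have hφeq : tDerivFun f S t =ᶠ[𝓝 x] φ := by
    filter_upwards [hV.mem_nhds hx] with y hy
    rw [hfeq y hy]
  -- `ḟ(x)`
  have hval : tDerivFun f S t x = -L + g2 - R + n / (2 * τ₀) := hfeq x hx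
  -- `Dḟ(ξ)`
  have hDφ : fderiv ℝ (tDerivFun f S t) x ξ = -DL + 2 * H ξ ξ - DS := by
    have hd : HasFDerivAt φ (-fderiv ℝ (lapAt (G t) (f t)) x + fderiv ℝ (gradSqAt (G t) (f t)) x
        - fderiv ℝ (scalAt (G t)) x) x :=
      ((hdL.hasFDerivAt.neg.add hdG.hasFDerivAt).sub hdS.hasFDerivAt).add_const _
    rw [hφeq.fderiv_eq, hd.fderiv]
    simp only [_root_.sub_apply, _root_.add_apply, _root_.neg_apply, hGt.fderiv_gradSqAt hx hft ξ]
    rfl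
  -- `Δḟ`
  have hLφ : lapAt (G t) (tDerivFun f S t) x = -LL + LG - LS := by
    rw [lapAt_congr_of_eventuallyEq _ hφeq, hφ, lapAt_add_const, lapAt_sub _ (h2L.neg.add h2G) h2S,
      lapAt_add _ h2L.neg h2G, lapAt_neg]
  -- (2) `ΔP` at time `t`
  have hP : entropyIntegrand G f τ t = fun y ↦ τ₀ * (2 * lapAt (G t) (f t) y
      - gradSqAt (G t) (f t) y + scalAt (G t) y) + f t y - n := by
    funext y; rfl
  have h2L2 : ContDiffAt ℝ 2 (fun y ↦ 2 * lapAt (G t) (f t) y) x := contDiffAt_const.mul h2L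
  have h2Q : ContDiffAt ℝ 2 (fun y ↦ 2 * lapAt (G t) (f t) y - gradSqAt (G t) (f t) y
      + scalAt (G t) y) x := (h2L2.sub h2G).add h2S
  have h2τQ : ContDiffAt ℝ 2 (fun y ↦ τ₀ * (2 * lapAt (G t) (f t) y - gradSqAt (G t) (f t) y
      + scalAt (G t) y)) x := contDiffAt_const.mul h2Q
  have hLP : lapAt (G t) (entropyIntegrand G f τ t) x = τ₀ * (2 * LL - LG + LS) + L := by
    rw [hP, lapAt_sub_const, lapAt_add _ h2τQ h2f, lapAt_const_mul _ h2Q, lapAt_add _ (h2L2.sub h2G) h2S,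
      lapAt_sub _ h2L2 h2G, lapAt_const_mul _ h2L]
  -- (3) `DP(ξ)` at time `t`
  have hDP : fderiv ℝ (entropyIntegrand G f τ t) x ξ = τ₀ * (2 * DL - 2 * H ξ ξ + DS) + g2 := by
    have hd : HasFDerivAt (entropyIntegrand G f τ t)
        (τ₀ • ((2 : ℝ) • fderiv ℝ (lapAt (G t) (f t)) x - fderiv ℝ (gradSqAt (G t) (f t)) x
          + fderiv ℝ (scalAt (G t)) x) + fderiv ℝ (f t) x) x := by
      rw [hP]
      exact (((((hdL.hasFDerivAt.const_mul (2 : ℝ)).sub hdG.hasFDerivAt).add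
        hdS.hasFDerivAt).const_mul τ₀).add hdf.hasFDerivAt).sub_const _
    rw [hd.fderiv]
    simp only [_root_.add_apply, _root_.sub_apply, _root_.smul_apply, smul_eq_mul,
      hGt.fderiv_gradSqAt hx hft ξ]
    rw [hg2, gradSqAt_apply]
  -- (4) `∂_t P`
  have hdt : tDerivFun (entropyIntegrand G f τ) S t x =
      (-1) * (2 * L - g2 + R) + τ₀ * (2 * (lapAt (G t) (tDerivFun f S t) x + 2 * pairAt (G t) x Rc H)
        - (2 * Rc ξ ξ + 2 * fderiv ℝ (tDerivFun f S t) x ξ) + (LS + 2 * normSqAt (G t) x Rc))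
        + tDerivFun f S t x :=
    (hG.hasDerivWithinAt_entropyIntegrand hfl hf hτ hx ht).derivWithin (hG.uniqueDiffOn t ht)
  -- (5) Bochner and the expansion of the square
  have hB : LG = 2 * normSqAt (G t) x H + 2 * DL + 2 * Rc ξ ξ := hGt.lapAt_gradSqAt hx hft
  have hHs : ∀ v w, H v w = H w v := hGt.hessAt_comm hx (contDiffAt_of_contDiffOn hV hft hx)
  have hRs : ∀ v w, Rc v w = Rc w v := hGt.ricAt_comm hx
  have hAs : ∀ v w, (Rc + H) v w = (Rc + H) w v := fun v w ↦ by
    simp only [_root_.add_apply, hRs v w, hHs v w]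
  have hsq : normSqAt (G t) x (Rc + H - (2 * τ₀)⁻¹ • G t x) =
      normSqAt (G t) x Rc + 2 * pairAt (G t) x Rc H + normSqAt (G t) x H
        - 2 * (2 * τ₀)⁻¹ * (R + L) + ((2 * τ₀)⁻¹) ^ 2 * n := by
    rw [normSqAt_sub_smul_metric hi hs hAs, normSqAt_add_of_symm hRs hHs, mtrAt_add]
    rfl
  -- (6) assemble
  rw [hdt, hLP, hDP, hLφ, hDφ, hval, hsq, hB]
  field_simp
  ring

end IsMetricFamilyOn

end Entropy

end MetricCoord

end Literature.Geometry.Lorentzian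

end
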